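import Mathlib
import Summits.MatrixMultiplication.MatrixMultiplication.Theorems.SnSubsetDichotomyPolynomialSlackHeavyMass
import Summits.MatrixMultiplication.MatrixMultiplication.Theorems.SnSubsetDichotomyPolynomialSlackMarginals

/-!
# Heavy cells of a pair profile carry only polylogarithmic mass

Crux `Summit.MatrixMultiplication.MatrixMultiplication.Theses.SnSubsetDichotomy.PolynomialSlack`
(item `stmt-MatrixMultiplication-8306`), level-one programme, line transport-split-hull (lead c6,
BEYOND ONE HALF). For `X, Y ⊆ S_n` with `(x,y) ↦ x⁻¹y` injective on `X × Y`, the PAIR PROFILE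
`d(i,j) = m_{XY}(i,j)/(|X||Y|)`, `m_{XY}(i,j) = #{(x,y) ∈ X × Y : y j = x i}`, is the normalised
marginal of the quotient set `A = X⁻¹Y`: `|A| = |X||Y|` (`card_image₂_of_injOn'`) and
`#{a ∈ A : a j = i} = m_{XY}(i,j)` (`pairMarginal_eq_marginal_image₂`). The heavy-mass bound
`heavy_mass_le` for `A` at level `λ = nθ ≥ 16`, divided by `|A|`, is the profile form

  `Σ_{(i,j) : d(i,j) ≥ θ} d(i,j) ≤ 200·(1 + log n)·log(4n·n!/(|X||Y|))`     (`pair_heavy_mass`),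

valid for every level `θ ≥ 16/n`.
-/

namespace Summit.MatrixMultiplication.MatrixMultiplication.Theorems.PolynomialSlack

set_option linter.dupNamespace false

open scoped BigOperators

/-- **Heavy cells of a pair profile carry little mass.** For non-empty `X, Y ⊆ S_n` (`n ≥ 1`) with
`(x,y) ↦ x⁻¹y` injective on `X × Y`, profile `d(i,j) = #{(x,y) ∈ X × Y : y j = x i}/(|X||Y|)` and a
level `θ ≥ 16/n`, the heavy mass `Σ_{i,j : d(i,j) ≥ θ} d(i,j)` is at most
`200·(1 + log n)·log(4n·n!/(|X||Y|))`. Proof: `d` is the normalised marginal of the quotient set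
`A = X⁻¹Y` (`|A| = |X||Y|`, `#{a ∈ A : a j = i} = |X||Y|·d(i,j)`), and `heavy_mass_le` for `A` at
level `λ = nθ ≥ 16` (threshold `λ|A|/n = θ|A|`) divided by `|A|` is the claim. [folklore] -/
theorem pair_heavy_mass {n : ℕ} (hn : 1 ≤ n) (X Y : Finset (Equiv.Perm (Fin n))) (hX : X.Nonempty)
    (hY : Y.Nonempty)
    (hinj : Set.InjOn (fun xy : Equiv.Perm (Fin n) × Equiv.Perm (Fin n) => xy.1⁻¹ * xy.2)
      (↑X ×ˢ ↑Y : Set (Equiv.Perm (Fin n) × Equiv.Perm (Fin n))))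
    (d : Fin n → Fin n → ℝ)
    (hd : ∀ i j, d i j =
      (((X ×ˢ Y).filter fun xy => xy.2 j = xy.1 i).card : ℝ) / (X.card * Y.card : ℕ))
    (θ : ℝ) (hθ : 16 / (n : ℝ) ≤ θ) :
    ∑ i : Fin n, ∑ j : Fin n, (if θ ≤ d i j then d i j else 0) ≤
      200 * (1 + Real.log n) * Real.log (4 * n * n.factorial / (X.card * Y.card : ℕ)) := by
  -- the quotient set `A = X⁻¹Y`: non-empty, of size `|X||Y|`, with marginals the pair marginals
  set A : Finset (Equiv.Perm (Fin n)) :=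
    Finset.image₂ (fun x y : Equiv.Perm (Fin n) => x⁻¹ * y) X Y with hA_def
  have hA : A.Nonempty := hX.image₂ hY
  have hcard : A.card = X.card * Y.card := card_image₂_of_injOn' hinj
  have hmarg : ∀ i j : Fin n, (((X ×ˢ Y).filter fun xy => xy.2 j = xy.1 i).card : ℝ) =
      ((A.filter fun a => a j = i).card : ℝ) := fun i j => by
    exact_mod_cast pairMarginal_eq_marginal_image₂ hinj i j
  -- real bookkeeping: `α = |X||Y| = |A| > 0`, `n > 0`
  have hnR : (0 : ℝ) < n := by exact_mod_cast hn
  set α : ℝ := ((X.card * Y.card : ℕ) : ℝ) with hα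
  have hαA : (A.card : ℝ) = α := by rw [hα, hcard]
  have hα0 : 0 < α := by rw [← hαA]; exact_mod_cast hA.card_pos
  -- the level `λ = nθ ≥ 16` and its threshold `λ·α/n = θ·α`
  have hlam : (16 : ℝ) ≤ n * θ := by
    have h := (div_le_iff₀ hnR).1 hθ
    linarith [mul_comm θ (n : ℝ)]
  have hthr : (n : ℝ) * θ * α / n = θ * α := by
    rw [mul_assoc, mul_comm, mul_div_assoc, div_self hnR.ne', mul_one]
  -- the tree bound for `A` at level `nθ`
  have htree := heavy_mass_le hn A hA (n * θ) hlam
  rw [hαA, hthr] at htree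
  -- cellwise: `α · (d 𝟙[θ ≤ d]) = M 𝟙[θα ≤ M]` with `M = #{a ∈ A : a j = i} = α d`
  have hcell : ∀ i j : Fin n, α * (if θ ≤ d i j then d i j else 0) =
      (if θ * α ≤ ((A.filter fun a => a j = i).card : ℝ) then
        ((A.filter fun a => a j = i).card : ℝ) else 0) := fun i j => by
    rw [hd i j, hmarg i j]
    by_cases h : θ * α ≤ ((A.filter fun a => a j = i).card : ℝ)
    · rw [if_pos ((le_div_iff₀ hα0).2 h), if_pos h, mul_div_cancel₀ _ hα0.ne']
    · rw [if_neg (fun h' => h ((le_div_iff₀ hα0).1 h')), if_neg h, mul_zero]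
  have hsum : α * ∑ i : Fin n, ∑ j : Fin n, (if θ ≤ d i j then d i j else 0) =
      ∑ i : Fin n, ∑ j : Fin n,
        (if θ * α ≤ ((A.filter fun a => a j = i).card : ℝ) then
          ((A.filter fun a => a j = i).card : ℝ) else 0) := by
    rw [Finset.mul_sum]
    refine Finset.sum_congr rfl fun i _ => ?_
    rw [Finset.mul_sum]
    exact Finset.sum_congr rfl fun j _ => hcell i j
  -- divide the tree bound by `α`
  have hmul : α * ∑ i : Fin n, ∑ j : Fin n, (if θ ≤ d i j then d i j else 0) ≤
      α * (200 * (1 + Real.log n) * Real.log (4 * n * n.factorial / α)) := by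
    rw [hsum]
    calc _ ≤ _ := htree
      _ = _ := by ring
  exact le_of_mul_le_mul_left hmul hα0

end Summit.MatrixMultiplication.MatrixMultiplication.Theorems.PolynomialSlack
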